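import Literature.NumberTheory.LFunctions.KloostermanFractionsReciprocity
import HarnessLib

/-!
# Trilinear forms with Kloosterman fractions: tools for Bettin–Chandee's §7 (general `A`)

Topic `NumberTheory/LFunctions`.  S. Bettin, V. Chandee, *Trilinear forms with Kloosterman
fractions*, Adv. Math. 328 (2018) 1234–1262 (arXiv:1502.00769), Theorem 1, is vendored as the named
fact `BettinChandee2018_trilinearKloostermanFractions`
(`BettinChandee2018TrilinearKloostermanFractions.lean`): for `ϑ ≠ 0`,
`𝓑(M,N,A) = ∑_a ∑_m ∑_{n,(m,n)=1} α_m β_n ν_a e(ϑ a m̄/n) ≪_ε ‖α‖‖β‖‖ν‖ (1+|ϑ|A/(MN))^{1/2}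
((AMN)^{7/20+ε}(M+N)^{1/4} + (AMN)^{3/8+ε}(AN+AM)^{1/8})`.  The tree's files
`KloostermanFractions*.lean` formalise the source's argument for a SINGLE numerator (`A = 1`);
this file starts the general-`A` (trilinear) version with the elementary tools of the LAST step of
the printed proof (§7, "Completion of the proof of Theorem 1") — all PROVED, no named facts:

* `BC_trilinear_trivial_bound` — "the trivial bound `𝓑(M,N,A) ≪ ‖α‖‖β‖‖ν‖(AMN)^{1/2}`"
  (here `≤ √8 (AMN)^{1/2} ‖α‖‖β‖‖ν‖`, boxes `(M,2M] × (N,2N] × (A,2A]` of the named fact);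
* `BC_trilinear_eq_swap` — "the elementary reciprocity law allows us to write
  `𝓑(M,N,A) = ∑∑∑ α_m β_n ν_a e(-ϑa n̄/m + ϑa/(mn))`" (from the tree's `DFI_e_reciprocity`):
  the trilinear form is the TWISTED trilinear form (numerator `-ϑ`, twist `e(ϑa/(mn))`) with the
  two inner variables exchanged; `BC_trilinear_twisted_zero`;
* `BC_terms73_le` — the exponent comparison (7.2) ⟹ Theorem 1:
  `(AMN)^ε (A^{1/2}M^{1/2}N^{3/8} + A^{7/20}M^{3/5}N^{7/20}) ≤ (AMN)^{7/20+ε}(M+N)^{1/4} + (AMN)^{3/8+ε}(AN+AM)^{1/8}`;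
* `BC_trivial_range` — the source's standing assumption "`A, b, ϑ, N ≪ M^C`" (§3) is removed at the
  end of §6 "since [the bound] is trivial otherwise": for `|ϑ| > 64(AMN)²` the trivial bound is
  below `8^{ε+2} (1+|ϑ|A/(MN))^{1/2}` times the right-hand side of Theorem 1; `BC_eps_factor_le`,
  `BC_W_two_le` — the accompanying `ε`-power and `(1 + 2x)^{1/2} ≤ √2 (1+x)^{1/2}` bookkeeping.

These are consumed by `TrilinearKloostermanFractionsReciprocity.lean` (Theorem 1 in all ranges from
(7.3) in the range `M ≥ N`).  Deliberately NOT here: anything from §§2–6 of the source.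

## References

* S. Bettin, V. Chandee, *Trilinear forms with Kloosterman fractions*, Adv. Math. 328 (2018)
  1234–1262, arXiv:1502.00769, Theorem 1, §6 (last sentence), §7. [BettinChandee2018]
-/

noncomputable section

open Finset Real

namespace Literature.NumberTheory.LFunctions

/-- The phase `e(ϑ a m̄/n)` of the trilinear form has modulus `1`. [folklore] -/
theorem BC_norm_triPhase (ϑ : ℤ) (a u n : ℕ) :
    ‖Complex.exp (2 * Real.pi * Complex.I *
        ((ϑ : ℂ) * (a : ℂ) * (u : ℂ) / (n : ℂ)))‖ = 1 := by
  have h : (2 * Real.pi * Complex.I * ((ϑ : ℂ) * (a : ℂ) * (u : ℂ) / (n : ℂ))) =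
      ((2 * Real.pi * ((ϑ : ℝ) * (a : ℝ) * (u : ℝ) / (n : ℝ)) : ℝ) : ℂ) * Complex.I := by
    push_cast; ring
  rw [h, Complex.norm_exp_ofReal_mul_I]

/-- The twisted phase `e(ϑ a m̄/n + η a/(mn))` has modulus `1`. [folklore] -/
theorem BC_norm_triPhase_twist (ϑ : ℤ) (η : ℝ) (a u m n : ℕ) :
    ‖Complex.exp (2 * Real.pi * Complex.I *
        ((ϑ : ℂ) * (a : ℂ) * (u : ℂ) / (n : ℂ) + (η : ℂ) * (a : ℂ) / ((m : ℂ) * (n : ℂ))))‖ = 1 := by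
  have h : (2 * Real.pi * Complex.I *
      ((ϑ : ℂ) * (a : ℂ) * (u : ℂ) / (n : ℂ) + (η : ℂ) * (a : ℂ) / ((m : ℂ) * (n : ℂ)))) =
      ((2 * Real.pi * ((ϑ : ℝ) * (a : ℝ) * (u : ℝ) / (n : ℝ) + η * (a : ℝ) / ((m : ℝ) * n)) : ℝ) :
        ℂ) * Complex.I := by
    push_cast; ring
  rw [h, Complex.norm_exp_ofReal_mul_I]

/-- Triple sums with coefficients `α_m β_n ν_a` times bounded weights:
`‖Σ_a Σ_m Σ_n F‖ ≤ (Σ_a |ν_a|)(Σ_m |α_m|)(Σ_n |β_n|)` when `|F(a,m,n)| ≤ |α_m||β_n||ν_a|`.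
[folklore] -/
theorem BC_norm_sum3_le (SA SM SN : Finset ℕ) (α β ν : ℕ → ℂ) (F : ℕ → ℕ → ℕ → ℂ)
    (hF : ∀ a m n, ‖F a m n‖ ≤ ‖α m‖ * ‖β n‖ * ‖ν a‖) :
    ‖∑ a ∈ SA, ∑ m ∈ SM, ∑ n ∈ SN, F a m n‖ ≤
      (∑ a ∈ SA, ‖ν a‖) * ((∑ m ∈ SM, ‖α m‖) * (∑ n ∈ SN, ‖β n‖)) := by
  calc ‖∑ a ∈ SA, ∑ m ∈ SM, ∑ n ∈ SN, F a m n‖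
      ≤ ∑ a ∈ SA, ‖∑ m ∈ SM, ∑ n ∈ SN, F a m n‖ := norm_sum_le _ _
    _ ≤ ∑ a ∈ SA, ∑ m ∈ SM, ∑ n ∈ SN, ‖ν a‖ * (‖α m‖ * ‖β n‖) := by
        refine Finset.sum_le_sum fun a _ => (norm_sum_le _ _).trans ?_
        refine Finset.sum_le_sum fun m _ => (norm_sum_le _ _).trans ?_
        refine Finset.sum_le_sum fun n _ => (hF a m n).trans_eq ?_
        ring
    _ = (∑ a ∈ SA, ‖ν a‖) * ((∑ m ∈ SM, ‖α m‖) * (∑ n ∈ SN, ‖β n‖)) := by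
        rw [Finset.sum_mul]
        refine Finset.sum_congr rfl fun a _ => ?_
        rw [Finset.sum_mul_sum, Finset.mul_sum]
        refine Finset.sum_congr rfl fun m _ => ?_
        rw [Finset.mul_sum]

/-- Cauchy–Schwarz on the box `1 ≤ m ≤ 2X`: `Σ |α_m| ≤ (2X)^{1/2} ‖α‖`. [folklore] -/
theorem BC_sum_norm_le_sqrt {X : ℝ} (hX : 0 ≤ X) (α : ℕ → ℂ) :
    ∑ m ∈ Icc 1 ⌊2 * X⌋₊, ‖α m‖ ≤
      Real.sqrt (2 * X) * Real.sqrt (∑ m ∈ Icc 1 ⌊2 * X⌋₊, ‖α m‖ ^ 2) := by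
  set SM := Icc 1 ⌊2 * X⌋₊ with hSM
  have hcard : (SM.card : ℝ) ≤ 2 * X := by
    rw [hSM, Nat.card_Icc]; simpa using Nat.floor_le (by positivity : (0 : ℝ) ≤ 2 * X)
  have h1 : (∑ m ∈ SM, ‖α m‖) ^ 2 ≤ (2 * X) * ∑ m ∈ SM, ‖α m‖ ^ 2 :=
    sq_sum_le_card_mul_sum_sq.trans (mul_le_mul_of_nonneg_right hcard
      (Finset.sum_nonneg fun _ _ => sq_nonneg _))
  calc ∑ m ∈ SM, ‖α m‖ = Real.sqrt ((∑ m ∈ SM, ‖α m‖) ^ 2) :=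
        (Real.sqrt_sq (Finset.sum_nonneg fun _ _ => norm_nonneg _)).symm
    _ ≤ Real.sqrt ((2 * X) * ∑ m ∈ SM, ‖α m‖ ^ 2) := Real.sqrt_le_sqrt h1
    _ = _ := Real.sqrt_mul (by positivity) _

/-- **The trivial bound for the trilinear form**:
`|𝓑(M,N,A)| ≤ √8 (AMN)^{1/2} ‖α‖‖β‖‖ν‖` ("the trivial bound
`𝓑(M,N,A) ≪ ‖α‖‖β‖‖ν‖(AMN)^{1/2}`", Bettin–Chandee after Theorem 1; Cauchy–Schwarz on the boxes
`1 ≤ m ≤ 2M`, `1 ≤ n ≤ 2N`, `1 ≤ a ≤ 2A`). [cite: BettinChandee2018, §1 (after Theorem 1)] -/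
theorem BC_trilinear_trivial_bound {M N A : ℝ} (hM : 0 ≤ M) (hN : 0 ≤ N) (hA : 0 ≤ A) (ϑ : ℤ)
    (α β ν : ℕ → ℂ) :
    ‖∑ a ∈ Icc 1 ⌊2 * A⌋₊, ∑ m ∈ Icc 1 ⌊2 * M⌋₊, ∑ n ∈ Icc 1 ⌊2 * N⌋₊,
        if m.Coprime n then
          α m * β n * ν a * Complex.exp (2 * Real.pi * Complex.I *
            ((ϑ : ℂ) * (a : ℂ) * ((((m : ZMod n)⁻¹).val : ℕ) : ℂ) / (n : ℂ)))
        else 0‖ ≤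
      Real.sqrt 8 * Real.sqrt (A * M * N) * Real.sqrt (∑ m ∈ Icc 1 ⌊2 * M⌋₊, ‖α m‖ ^ 2) *
        Real.sqrt (∑ n ∈ Icc 1 ⌊2 * N⌋₊, ‖β n‖ ^ 2) *
        Real.sqrt (∑ a ∈ Icc 1 ⌊2 * A⌋₊, ‖ν a‖ ^ 2) := by
  have hF : ∀ a m n : ℕ, ‖(if m.Coprime n then
      α m * β n * ν a * Complex.exp (2 * Real.pi * Complex.I *
        ((ϑ : ℂ) * (a : ℂ) * ((((m : ZMod n)⁻¹).val : ℕ) : ℂ) / (n : ℂ))) else 0)‖ ≤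
      ‖α m‖ * ‖β n‖ * ‖ν a‖ := by
    intro a m n
    split_ifs
    · rw [norm_mul, norm_mul, norm_mul, BC_norm_triPhase, mul_one]
    · rw [norm_zero]; positivity
  have h3 := BC_norm_sum3_le (Icc 1 ⌊2 * A⌋₊) (Icc 1 ⌊2 * M⌋₊) (Icc 1 ⌊2 * N⌋₊) α β ν _ hF
  have hA' := BC_sum_norm_le_sqrt hA ν
  have hM' := BC_sum_norm_le_sqrt hM α
  have hN' := BC_sum_norm_le_sqrt hN β
  have hsqrt : Real.sqrt (2 * A) * (Real.sqrt (2 * M) * Real.sqrt (2 * N)) =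
      Real.sqrt 8 * Real.sqrt (A * M * N) := by
    rw [← Real.sqrt_mul (by positivity), ← Real.sqrt_mul (by positivity),
      ← Real.sqrt_mul (by positivity)]
    congr 1; ring
  calc _ ≤ _ := h3
    _ ≤ (Real.sqrt (2 * A) * Real.sqrt (∑ a ∈ Icc 1 ⌊2 * A⌋₊, ‖ν a‖ ^ 2)) *
          ((Real.sqrt (2 * M) * Real.sqrt (∑ m ∈ Icc 1 ⌊2 * M⌋₊, ‖α m‖ ^ 2)) *
            (Real.sqrt (2 * N) * Real.sqrt (∑ n ∈ Icc 1 ⌊2 * N⌋₊, ‖β n‖ ^ 2))) := by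
        have h0 : 0 ≤ ∑ n ∈ Icc 1 ⌊2 * N⌋₊, ‖β n‖ :=
          Finset.sum_nonneg fun _ _ => norm_nonneg _
        have h0' : 0 ≤ ∑ m ∈ Icc 1 ⌊2 * M⌋₊, ‖α m‖ :=
          Finset.sum_nonneg fun _ _ => norm_nonneg _
        gcongr
    _ = _ := by rw [← hsqrt]; ring

/-- **Reciprocity for the trilinear form** (Bettin–Chandee, end of §7: "the elementary reciprocity
law allows us to write `𝓑(M,N,A) = ∑∑∑ α_m β_n ν_a e(-ϑa n̄/m + ϑa/(mn))`"): the trilinear form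
equals, after exchanging the two inner variables, the twisted trilinear form with numerator `-ϑ`
and twist `η = ϑ` (from `DFI_e_reciprocity`, `m m̄ + n n̄ ≡ 1 (mod mn)`).
[cite: BettinChandee2018, §7] -/
theorem BC_trilinear_eq_swap (M N A : ℝ) (ϑ : ℤ) (α β ν : ℕ → ℂ) :
    (∑ a ∈ Icc 1 ⌊2 * A⌋₊, ∑ m ∈ Icc 1 ⌊2 * M⌋₊, ∑ n ∈ Icc 1 ⌊2 * N⌋₊,
        if m.Coprime n then
          α m * β n * ν a * Complex.exp (2 * Real.pi * Complex.I *
            ((ϑ : ℂ) * (a : ℂ) * ((((m : ZMod n)⁻¹).val : ℕ) : ℂ) / (n : ℂ)))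
        else 0) =
      ∑ a ∈ Icc 1 ⌊2 * A⌋₊, ∑ n ∈ Icc 1 ⌊2 * N⌋₊, ∑ m ∈ Icc 1 ⌊2 * M⌋₊,
        if n.Coprime m then
          β n * α m * ν a * Complex.exp (2 * Real.pi * Complex.I *
            (((-ϑ : ℤ) : ℂ) * (a : ℂ) * ((((n : ZMod m)⁻¹).val : ℕ) : ℂ) / (m : ℂ) +
              ((ϑ : ℝ) : ℂ) * (a : ℂ) / ((n : ℂ) * (m : ℂ))))
        else 0 := by
  refine Finset.sum_congr rfl fun a _ => ?_
  rw [Finset.sum_comm]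
  refine Finset.sum_congr rfl fun n hn => Finset.sum_congr rfl fun m hm => ?_
  have hm0 : 0 < m := (Finset.mem_Icc.mp hm).1
  have hn0 : 0 < n := (Finset.mem_Icc.mp hn).1
  by_cases h : m.Coprime n
  · rw [if_pos h, if_pos (Nat.coprime_comm.mp h)]
    have key := DFI_e_reciprocity hm0 hn0 h (ϑ * a)
    have e1 : (2 * Real.pi * Complex.I *
        ((ϑ : ℂ) * (a : ℂ) * ((((m : ZMod n)⁻¹).val : ℕ) : ℂ) / (n : ℂ))) =
        2 * Real.pi * Complex.I *
          (((ϑ * a : ℤ) : ℂ) * ((((m : ZMod n)⁻¹).val : ℕ) : ℂ) / (n : ℂ)) := by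
      push_cast; ring
    have e2 : (2 * Real.pi * Complex.I *
        (((-ϑ : ℤ) : ℂ) * (a : ℂ) * ((((n : ZMod m)⁻¹).val : ℕ) : ℂ) / (m : ℂ) +
          ((ϑ : ℝ) : ℂ) * (a : ℂ) / ((n : ℂ) * (m : ℂ)))) =
        2 * Real.pi * Complex.I *
          (((-(ϑ * a) : ℤ) : ℂ) * ((((n : ZMod m)⁻¹).val : ℕ) : ℂ) / (m : ℂ) +
            ((((ϑ * a : ℤ) : ℝ)) : ℂ) / ((n : ℂ) * m)) := by
      push_cast; ring
    rw [e1, e2, key]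
    ring
  · rw [if_neg h, if_neg (fun h' => h (Nat.coprime_comm.mp h'))]

/-- The twisted trilinear form at `η = 0` is the untwisted one. [folklore] -/
theorem BC_trilinear_twisted_zero (M N A : ℝ) (ϑ : ℤ) (α β ν : ℕ → ℂ) :
    (∑ a ∈ Icc 1 ⌊2 * A⌋₊, ∑ m ∈ Icc 1 ⌊2 * M⌋₊, ∑ n ∈ Icc 1 ⌊2 * N⌋₊,
        if m.Coprime n then
          α m * β n * ν a * Complex.exp (2 * Real.pi * Complex.I *
            ((ϑ : ℂ) * (a : ℂ) * ((((m : ZMod n)⁻¹).val : ℕ) : ℂ) / (n : ℂ) +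
              ((0 : ℝ) : ℂ) * (a : ℂ) / ((m : ℂ) * (n : ℂ))))
        else 0) =
      ∑ a ∈ Icc 1 ⌊2 * A⌋₊, ∑ m ∈ Icc 1 ⌊2 * M⌋₊, ∑ n ∈ Icc 1 ⌊2 * N⌋₊,
        if m.Coprime n then
          α m * β n * ν a * Complex.exp (2 * Real.pi * Complex.I *
            ((ϑ : ℂ) * (a : ℂ) * ((((m : ZMod n)⁻¹).val : ℕ) : ℂ) / (n : ℂ)))
        else 0 := by
  simp only [Complex.ofReal_zero, zero_mul, zero_div, add_zero]

/-- **The exponents of Bettin–Chandee (7.2)/(7.3) versus Theorem 1**: for `A, M, N > 0` and real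
`ε`, `(AMN)^ε (A^{1/2}M^{1/2}N^{3/8} + A^{7/20}M^{3/5}N^{7/20}) ≤
(AMN)^{7/20+ε}(M+N)^{1/4} + (AMN)^{3/8+ε}(AN+AM)^{1/8}` (`A^{1/2}M^{1/2}N^{3/8} =
(AMN)^{3/8}(AM)^{1/8}`, `A^{7/20}M^{3/5}N^{7/20} = (AMN)^{7/20}M^{1/4}`, `M ≤ M + N`).
[cite: BettinChandee2018, §7 ((7.2) ⟹ Theorem 1 for `M ≥ N`)] -/
theorem BC_terms73_le {A M N : ℝ} (ε : ℝ) (hA : 0 < A) (hM : 0 < M) (hN : 0 < N) :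
    (A * M * N) ^ ε * (A ^ (1 / 2 : ℝ) * M ^ (1 / 2 : ℝ) * N ^ (3 / 8 : ℝ) +
        A ^ (7 / 20 : ℝ) * M ^ (3 / 5 : ℝ) * N ^ (7 / 20 : ℝ)) ≤
      (A * M * N) ^ (7 / 20 + ε) * (M + N) ^ (1 / 4 : ℝ) +
        (A * M * N) ^ (3 / 8 + ε) * (A * N + A * M) ^ (1 / 8 : ℝ) := by
  have hP : 0 < A * M * N := by positivity
  have hS : 0 < M + N := by linarith
  have hQ : 0 < A * N + A * M := by positivity
  obtain ⟨la, hla⟩ : ∃ la : ℝ, la = Real.log A := ⟨_, rfl⟩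
  obtain ⟨u, hu⟩ : ∃ u : ℝ, u = Real.log M := ⟨_, rfl⟩
  obtain ⟨v, hv⟩ : ∃ v : ℝ, v = Real.log N := ⟨_, rfl⟩
  obtain ⟨p, hp⟩ : ∃ p : ℝ, p = Real.log (M + N) := ⟨_, rfl⟩
  have hup : u ≤ p := by rw [hu, hp]; exact Real.log_le_log hM (by linarith)
  have hlogP : Real.log (A * M * N) = la + u + v := by
    rw [Real.log_mul (by positivity) hN.ne', Real.log_mul hA.ne' hM.ne', hla, hu, hv]
  have hlogQ : Real.log (A * N + A * M) = la + p := by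
    rw [show A * N + A * M = A * (M + N) by ring, Real.log_mul hA.ne' hS.ne', hla, hp]
  have eA : ∀ c : ℝ, A ^ c = Real.exp (c * la) := fun c => by
    rw [Real.rpow_def_of_pos hA, mul_comm, hla]
  have eM : ∀ c : ℝ, M ^ c = Real.exp (c * u) := fun c => by
    rw [Real.rpow_def_of_pos hM, mul_comm, hu]
  have eN : ∀ c : ℝ, N ^ c = Real.exp (c * v) := fun c => by
    rw [Real.rpow_def_of_pos hN, mul_comm, hv]
  have eP : ∀ c : ℝ, (A * M * N) ^ c = Real.exp (c * (la + u + v)) := fun c => by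
    rw [Real.rpow_def_of_pos hP, mul_comm, hlogP]
  have eS : ∀ c : ℝ, (M + N) ^ c = Real.exp (c * p) := fun c => by
    rw [Real.rpow_def_of_pos hS, mul_comm, hp]
  have eQ : ∀ c : ℝ, (A * N + A * M) ^ c = Real.exp (c * (la + p)) := fun c => by
    rw [Real.rpow_def_of_pos hQ, mul_comm, hlogQ]
  have h1 : (A * M * N) ^ ε * (A ^ (1 / 2 : ℝ) * M ^ (1 / 2 : ℝ) * N ^ (3 / 8 : ℝ)) ≤
      (A * M * N) ^ (3 / 8 + ε) * (A * N + A * M) ^ (1 / 8 : ℝ) := by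
    rw [eP, eA, eM, eN, eP, eQ, ← Real.exp_add, ← Real.exp_add, ← Real.exp_add, ← Real.exp_add]
    exact Real.exp_le_exp.mpr (by linarith)
  have h2 : (A * M * N) ^ ε * (A ^ (7 / 20 : ℝ) * M ^ (3 / 5 : ℝ) * N ^ (7 / 20 : ℝ)) ≤
      (A * M * N) ^ (7 / 20 + ε) * (M + N) ^ (1 / 4 : ℝ) := by
    rw [eP, eA, eM, eN, eP, eS, ← Real.exp_add, ← Real.exp_add, ← Real.exp_add, ← Real.exp_add]
    exact Real.exp_le_exp.mpr (by linarith)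
  rw [mul_add, add_comm ((A * M * N) ^ (7 / 20 + ε) * (M + N) ^ (1 / 4 : ℝ))]
  exact add_le_add h1 h2

/-- The `ε`-power bookkeeping of §7: if `1 ≤ t ≤ 64 P²` and `0 ≤ s ≤ t` then
`((1 + t + s) P)^{ε/3} ≤ 192^{ε/3} P^ε` (`1 + t + s ≤ 3t ≤ 192 P²`). [folklore] -/
theorem BC_eps_factor_le {P t s ε : ℝ} (hP : 0 < P) (hε : 0 ≤ ε) (ht : 1 ≤ t) (hs0 : 0 ≤ s)
    (hs : s ≤ t) (htP : t ≤ 64 * P ^ 2) :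
    ((1 + t + s) * P) ^ (ε / 3) ≤ (192 : ℝ) ^ (ε / 3) * P ^ ε := by
  have h1 : (1 + t + s) * P ≤ 192 * P ^ 3 := by
    have : 1 + t + s ≤ 3 * t := by linarith
    calc (1 + t + s) * P ≤ 3 * t * P := by gcongr
      _ ≤ 3 * (64 * P ^ 2) * P := by gcongr
      _ = 192 * P ^ 3 := by ring
  have h0 : 0 ≤ (1 + t + s) * P := by positivity
  calc ((1 + t + s) * P) ^ (ε / 3) ≤ (192 * P ^ 3) ^ (ε / 3) :=
        Real.rpow_le_rpow h0 h1 (by positivity)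
    _ = (192 : ℝ) ^ (ε / 3) * (P ^ 3) ^ (ε / 3) := Real.mul_rpow (by norm_num) (by positivity)
    _ = (192 : ℝ) ^ (ε / 3) * P ^ ε := by
        congr 1
        rw [show (P ^ 3 : ℝ) = P ^ ((3 : ℕ) : ℝ) from (Real.rpow_natCast P 3).symm,
          ← Real.rpow_mul hP.le]
        congr 1; push_cast; ring

/-- `(1 + 2x)^{1/2} ≤ √2 (1 + x)^{1/2}` for `x ≥ 0`. [folklore] -/
theorem BC_W_two_le {x : ℝ} (hx : 0 ≤ x) :
    (1 + (x + x)) ^ (1 / 2 : ℝ) ≤ Real.sqrt 2 * (1 + x) ^ (1 / 2 : ℝ) := by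
  have h : 1 + (x + x) ≤ 2 * (1 + x) := by linarith
  calc (1 + (x + x)) ^ (1 / 2 : ℝ) ≤ (2 * (1 + x)) ^ (1 / 2 : ℝ) :=
        Real.rpow_le_rpow (by positivity) h (by norm_num)
    _ = (2 : ℝ) ^ (1 / 2 : ℝ) * (1 + x) ^ (1 / 2 : ℝ) := Real.mul_rpow (by norm_num) (by positivity)
    _ = Real.sqrt 2 * (1 + x) ^ (1 / 2 : ℝ) := by rw [Real.sqrt_eq_rpow]

/-- **The trivial range** (Bettin–Chandee, end of §6: the standing assumption `ϑ ≪ M^C` is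
harmless "since [the bound] is trivial otherwise"): if `|ϑ| > 64 (AMN)²` (`A, M, N ≥ 1/2`) then the
trivial bound `√8 (AMN)^{1/2}` is at most `8^{ε+2} (1 + |ϑ|A/(MN))^{1/2}` times the right-hand
side of Theorem 1 (indeed `(|ϑ|A/(MN))^{1/2} > 8A(AMN)^{1/2}`, `(AMN)^{3/8+ε} ≥ 8^{-3/8-ε}`,
`(AN+AM)^{1/8} ≥ 2^{-1/8}`). [cite: BettinChandee2018, §6 (last sentence)] -/
theorem BC_trivial_range {A M N t ε : ℝ} (hε : 0 < ε) (hM : 1 / 2 ≤ M) (hN : 1 / 2 ≤ N)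
    (hA : 1 / 2 ≤ A) (ht : 64 * (A * M * N) ^ 2 < t) :
    Real.sqrt 8 * Real.sqrt (A * M * N) ≤
      (8 : ℝ) ^ (ε + 2) * (1 + t * A / (M * N)) ^ (1 / 2 : ℝ) *
        ((A * M * N) ^ (7 / 20 + ε) * (M + N) ^ (1 / 4 : ℝ) +
          (A * M * N) ^ (3 / 8 + ε) * (A * N + A * M) ^ (1 / 8 : ℝ)) := by
  have hM0 : 0 < M := by linarith
  have hN0 : 0 < N := by linarith
  have hA0 : 0 < A := by linarith
  set P : ℝ := A * M * N with hPdef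
  have hP0 : 0 < P := by positivity
  have hP8 : 1 / 8 ≤ P := by
    have h1 : (1 / 2 : ℝ) * (1 / 2) ≤ A * M := mul_le_mul hA hM (by norm_num) hA0.le
    have h2 : (1 / 2 : ℝ) * (1 / 2) * (1 / 2) ≤ A * M * N :=
      mul_le_mul h1 hN (by norm_num) (by positivity)
    rw [hPdef]; linarith
  -- `W ≥ 8 A √P`
  set x : ℝ := t * A / (M * N) with hx
  have hx0 : 0 ≤ x := by
    rw [hx]; have : 0 ≤ t := by nlinarith [sq_nonneg P]
    positivity
  have hxlow : 64 * P * A ^ 2 ≤ x := by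
    have e : 64 * P * A ^ 2 = 64 * P ^ 2 * (A / (M * N)) := by
      rw [hPdef]; field_simp
    have e' : x = t * (A / (M * N)) := by rw [hx]; ring
    rw [e, e']
    exact mul_le_mul_of_nonneg_right ht.le (by positivity)
  have hW : 8 * A * Real.sqrt P ≤ (1 + x) ^ (1 / 2 : ℝ) := by
    have h1 : Real.sqrt (64 * P * A ^ 2) = 8 * A * Real.sqrt P := by
      rw [show 64 * P * A ^ 2 = (8 * A) ^ 2 * P by ring, Real.sqrt_mul (sq_nonneg (8 * A)) P,
        Real.sqrt_sq (by positivity)]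
    rw [← h1, ← Real.sqrt_eq_rpow]
    exact Real.sqrt_le_sqrt (by linarith)
  -- lower bounds for the Theorem-1 terms
  have hT1 : 0 ≤ (A * M * N) ^ (7 / 20 + ε) * (M + N) ^ (1 / 4 : ℝ) := by positivity
  have hPpow : (1 / 8 : ℝ) ^ (3 / 8 + ε) ≤ P ^ (3 / 8 + ε) :=
    Real.rpow_le_rpow (by norm_num) hP8 (by linarith)
  have hSpow : (1 / 2 : ℝ) ≤ (A * N + A * M) ^ (1 / 8 : ℝ) := by
    have hS : (1 / 2 : ℝ) ≤ A * N + A * M := by nlinarith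
    calc (1 / 2 : ℝ) = (1 / 2 : ℝ) ^ (1 : ℝ) := (Real.rpow_one _).symm
      _ ≤ (1 / 2 : ℝ) ^ (1 / 8 : ℝ) :=
          Real.rpow_le_rpow_of_exponent_ge (by norm_num) (by norm_num) (by norm_num)
      _ ≤ (A * N + A * M) ^ (1 / 8 : ℝ) := Real.rpow_le_rpow (by norm_num) hS (by norm_num)
  -- the constants: `8^{ε+2} (1/8)^{3/8+ε} = 8^{13/8} ≥ 8`
  have hconst : (8 : ℝ) ≤ (8 : ℝ) ^ (ε + 2) * (1 / 8 : ℝ) ^ (3 / 8 + ε) := by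
    have e1 : (8 : ℝ) ^ (ε + 2) = (8 : ℝ) ^ ε * (8 : ℝ) ^ (2 : ℝ) := Real.rpow_add (by norm_num) _ _
    have e2 : (1 / 8 : ℝ) ^ (3 / 8 + ε) = (1 / 8 : ℝ) ^ (3 / 8 : ℝ) * (1 / 8 : ℝ) ^ ε :=
      Real.rpow_add (by norm_num) _ _
    have e3 : (8 : ℝ) ^ ε * (1 / 8 : ℝ) ^ ε = 1 := by
      rw [← Real.mul_rpow (by norm_num) (by norm_num)]; norm_num
    have e4 : (8 : ℝ) ^ (2 : ℝ) = 64 := by norm_num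
    have e5 : (1 / 8 : ℝ) ≤ (1 / 8 : ℝ) ^ (3 / 8 : ℝ) := by
      calc (1 / 8 : ℝ) = (1 / 8 : ℝ) ^ (1 : ℝ) := (Real.rpow_one _).symm
        _ ≤ (1 / 8 : ℝ) ^ (3 / 8 : ℝ) :=
            Real.rpow_le_rpow_of_exponent_ge (by norm_num) (by norm_num) (by norm_num)
    have h8ε : 0 ≤ (8 : ℝ) ^ ε := by positivity
    have h18ε : 0 ≤ (1 / 8 : ℝ) ^ ε := by positivity
    calc (8 : ℝ) = 64 * (1 / 8) * 1 := by norm_num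
      _ ≤ 64 * (1 / 8 : ℝ) ^ (3 / 8 : ℝ) * ((8 : ℝ) ^ ε * (1 / 8 : ℝ) ^ ε) := by
          rw [e3]; gcongr
      _ = (8 : ℝ) ^ (ε + 2) * (1 / 8 : ℝ) ^ (3 / 8 + ε) := by rw [e1, e2, e4]; ring
  have hsqrt8 : Real.sqrt 8 ≤ 3 := by
    rw [Real.sqrt_le_left (by norm_num)]; norm_num
  -- assemble
  have hsP : 0 ≤ Real.sqrt P := Real.sqrt_nonneg _
  calc Real.sqrt 8 * Real.sqrt (A * M * N) ≤ 3 * Real.sqrt P := by rw [← hPdef]; gcongr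
    _ ≤ 8 * (8 * (1 / 2) * Real.sqrt P) * (1 / 2) := by nlinarith
    _ ≤ ((8 : ℝ) ^ (ε + 2) * (1 / 8 : ℝ) ^ (3 / 8 + ε)) * (8 * A * Real.sqrt P) *
          (A * N + A * M) ^ (1 / 8 : ℝ) := by gcongr
    _ = (8 : ℝ) ^ (ε + 2) * (8 * A * Real.sqrt P) *
          ((1 / 8 : ℝ) ^ (3 / 8 + ε) * (A * N + A * M) ^ (1 / 8 : ℝ)) := by ring
    _ ≤ (8 : ℝ) ^ (ε + 2) * (1 + x) ^ (1 / 2 : ℝ) *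
          (P ^ (3 / 8 + ε) * (A * N + A * M) ^ (1 / 8 : ℝ)) := by gcongr
    _ ≤ (8 : ℝ) ^ (ε + 2) * (1 + x) ^ (1 / 2 : ℝ) *
          ((A * M * N) ^ (7 / 20 + ε) * (M + N) ^ (1 / 4 : ℝ) +
            P ^ (3 / 8 + ε) * (A * N + A * M) ^ (1 / 8 : ℝ)) := by
        have : 0 ≤ (8 : ℝ) ^ (ε + 2) * (1 + x) ^ (1 / 2 : ℝ) := by positivity
        nlinarith

end Literature.NumberTheory.LFunctions

end
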